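import Literature.Analysis.UnboundedOperators.LinearizedBoltzmannKernelProofs
import Literature.Analysis.UnboundedOperators.LinearizedBoltzmannSpectralGapProofs
import Literature.Analysis.UnboundedOperators.LinearizedBoltzmannAction
import Literature.Analysis.UnboundedOperators.LinearizedBoltzmannBddAboveProofs
import Literature.Analysis.FluidPDE.BoltzmannEquation
import HarnessLib

/-!
# The linearised Enskog (hard-sphere) collision operator at a local Maxwellian

Topic: MathematicalPhysics / KineticTheory (definition request `LinearizedEnskogOperator` of route
`ChapmanEnskogCorrector`, AtomisticToContinuum / HydrodynamicLimit). Velocity space: a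
finite-dimensional real inner product space `E` (`ℝ³ = EuclideanSpace ℝ (Fin 3)` in the route).

Linearising Enskog's hard-sphere collision operator with contact factor `Y` (Chapman–Cowling's `χ`)
at the local Maxwellian `M_{ρ,u,θ}(v) = ρ (2πθ)^{-d/2} e^{-|v-u|²/(2θ)}`, `f = M_{ρ,u,θ}(1 + g)`, and
dropping the spatial delocalisation (diameter `ε = 0`) gives the operator
`𝓛♭_{Y,ρ,u,θ} g (v) = Y ∫_E ∫_{S^{d-1}} ((v - v_*)·ω)_+ (g(v') + g(v_*') - g(v) - g(v_*)) dω M_{ρ,u,θ}(v_*) dv_*`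
(Chapman–Cowling 1970 §16.31–16.33, (16.32,2)–(16.33,1): `χ ∬ f⁽⁰⁾ f₁⁽⁰⁾ (Φ' + Φ₁' - Φ - Φ₁) σ² g·k dk dc₁`,
divided by `f⁽⁰⁾ = M_{ρ,u,θ}`; as everywhere in this tree (`Hilbert6Wave0.collisionOp`,
`hardSphereLinearizedOp`) the cross-section factor `σ²` is not part of the operator). By
translation and scaling invariance of the hard-sphere kernel (Saint-Raymond 2009 §3.2.2 (3.16):
`𝓛_{M_{R,U,T}} φ = (R √T) τ_U m_{√T} 𝓛_M (m_{1/√T} τ_{-U} φ)`) this is the conjugate of the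
linearised hard-sphere Boltzmann operator `L = Literature.Analysis.UnboundedOperators.hardSphereLinearizedOp`
around the standard Gaussian by the peculiar-velocity map `v ↦ (v - u)/√θ`, times `Y ρ √θ`.
This file provides:

* `toPeculiar u θ`, `ofPeculiar u θ` — the affine rescaling `v ↦ (v - u)/√θ` and its inverse
  `ξ ↦ u + √θ ξ`, with the transfer of temperate growth and of the collision invariants;
* `localMaxwellianInner u θ g h = ∫ g h dN(u, θ I)` — the `L²(M_{1,u,θ} dv)` pairing (by transport;
  `localMaxwellianInner_eq_integral` is the explicit integral);
* `linearizedEnskogOperator Y ρ u θ g` — **the operator `𝓛♭`**, *defined* by the conjugation above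
  and *proved* equal to the displayed integral (`linearizedEnskogOperator_eq_integral`); symmetric
  and non-positive for `⟪·,·⟫_{u,θ}` on functions of temperate growth, kernel = collision
  invariants, spectral gap `Y ρ √θ λ` (all transported from the discharged facts of
  `LinearizedBoltzmann.lean`: CIP 1994 §7.1 (1.9)–(1.10), Thm 7.2.1; Grad 1963 / Baranger–Mouhot);
* `IsChapmanEnskogSolution A g`, `chapmanEnskogInv A`, `linearizedEnskogOperatorInv Y ρ u θ A` —
  **the Chapman–Enskog pseudo-inverse `𝓛♭⁻¹`** on the `M`-orthogonal complement of the collision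
  invariants: the (unique, `IsChapmanEnskogSolution.unique`) temperate-growth solution orthogonal to
  the collision invariants when it exists, junk value `0` otherwise (Saint-Raymond 2009 Remark 3.2.3:
  `𝓛_M⁻¹` on `(Ker 𝓛_M)^⊥`, `Φ̃ = 𝓛⁻¹Φ`, `Ψ̃ = 𝓛⁻¹Ψ`; Chapman–Cowling 1970 (16.33,6): the Enskog
  solution is the dilute one divided by `n χ`);
* `linearizedEnskogOperatorDeloc G ε Y ρ u θ g` — the delocalised (genuinely Enskog) version with the
  collision partner displaced by `∓ ε ω` (Chapman–Cowling 1970 (16.3,4); Soto 2016 (4.87)), for a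
  position space with a `Literature.Analysis.FluidPDE.Geometry`, frozen parameters `(Y, ρ, u, θ)`;
  at `ε = 0` it is `𝓛♭` applied fibrewise (`linearizedEnskogOperatorDeloc_zero`).

## What is NOT here (deliberately)

* No existence statement for Chapman–Enskog solutions is vendored: the published Fredholm
  alternative (Saint-Raymond 2009 Prop. 3.2.2, CIP 1994 Thm 7.2.1/7.2.5, Golse–Saint-Raymond 2009 §2)
  lives in `L²(M dv)`; pointwise/temperate-growth bounds for `𝓛⁻¹A`, `𝓛⁻¹B` (Burnett data) are not
  printed in a source we hold, so users carry `∃ g, IsChapmanEnskogSolution A g` as a hypothesis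
  (`chapmanEnskogInv_spec`, `linearizedEnskogOperatorInv_spec`).
* The revised-Enskog (van Beijeren–Ernst 1973) linearisation with `x`-dependent parameters and the
  functional derivative of `Y` is not covered: `linearizedEnskogOperatorDeloc` freezes `(Y, ρ, u, θ)`.

## References

* S. Chapman, T. G. Cowling, *The Mathematical Theory of Non-uniform Gases*, 3rd ed. (1970), §16.3
  (16.3,4), §16.31–16.33 (16.33,1), (16.33,5)–(16.33,6).
* L. Saint-Raymond, *Hydrodynamic Limits of the Boltzmann Equation*, LNM 1971 (2009), §3.2.2
  (3.15)–(3.17), Prop. 3.2.2, Remark 3.2.3.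
* C. Cercignani, R. Illner, M. Pulvirenti, *The Mathematical Theory of Dilute Gases* (1994), §7.1
  (1.6)–(1.10), §7.2 Thm 7.2.1.
* R. Soto, *Kinetic Theory and Transport Phenomena* (2016), §4.8.1 (4.87).
* H. van Beijeren, M. H. Ernst, Physica 68 (1973) 437–456; P. Résibois, J. Stat. Phys. 19 (1978).
-/

open MeasureTheory Metric Real ProbabilityTheory Module
open scoped InnerProductSpace

namespace Literature.MathematicalPhysics.KineticTheory

noncomputable section

open Literature.Analysis.UnboundedOperators Literature.Analysis.FluidPDE

variable {E : Type*} [NormedAddCommGroup E] [InnerProductSpace ℝ E]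

/-! ### The peculiar-velocity rescaling -/

/-- The peculiar-velocity map of the local Maxwellian `M_{ρ,u,θ}`: `v ↦ (v - u)/√θ`
(Chapman–Cowling 1970 §16.31: `C = c - c₀`, scaled by the thermal speed; Saint-Raymond 2009 (3.16):
`m_{1/√T} τ_{-U}`). Junk for `θ ≤ 0` (`√θ = 0`, the map is constant `0`). [cite: SaintRaymond2009, §3.2.2 (3.16)] -/
def toPeculiar (u : E) (θ : ℝ) (v : E) : E :=
  (√θ)⁻¹ • (v - u)

/-- The inverse rescaling `ξ ↦ u + √θ ξ` (Saint-Raymond 2009 (3.16): `τ_U m_{√T}`).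
[cite: SaintRaymond2009, §3.2.2 (3.16)] -/
def ofPeculiar (u : E) (θ : ℝ) (ξ : E) : E :=
  u + √θ • ξ

/-- `toPeculiar ∘ ofPeculiar = id` for `θ > 0`. [folklore] -/
@[simp]
theorem toPeculiar_ofPeculiar {θ : ℝ} (hθ : 0 < θ) (u ξ : E) :
    toPeculiar u θ (ofPeculiar u θ ξ) = ξ := by
  have hc : (√θ : ℝ) ≠ 0 := (Real.sqrt_pos.2 hθ).ne'
  simp [toPeculiar, ofPeculiar, smul_smul, inv_mul_cancel₀ hc]

/-- `ofPeculiar ∘ toPeculiar = id` for `θ > 0`. [folklore] -/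
@[simp]
theorem ofPeculiar_toPeculiar {θ : ℝ} (hθ : 0 < θ) (u v : E) :
    ofPeculiar u θ (toPeculiar u θ v) = v := by
  have hc : (√θ : ℝ) ≠ 0 := (Real.sqrt_pos.2 hθ).ne'
  simp [toPeculiar, ofPeculiar, smul_smul, mul_inv_cancel₀ hc]

/-- `(g ∘ ofPeculiar) ∘ toPeculiar = g` for `θ > 0`. [folklore] -/
theorem comp_ofPeculiar_comp_toPeculiar {X : Type*} {θ : ℝ} (hθ : 0 < θ) (u : E) (g : E → X) :
    (g ∘ ofPeculiar u θ) ∘ toPeculiar u θ = g := by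
  funext v
  simp [ofPeculiar_toPeculiar hθ]

/-- `(g ∘ toPeculiar) ∘ ofPeculiar = g` for `θ > 0`. [folklore] -/
theorem comp_toPeculiar_comp_ofPeculiar {X : Type*} {θ : ℝ} (hθ : 0 < θ) (u : E) (g : E → X) :
    (g ∘ toPeculiar u θ) ∘ ofPeculiar u θ = g := by
  funext v
  simp [toPeculiar_ofPeculiar hθ]

/-- The peculiar-velocity map is affine: `toPeculiar u θ v = -(√θ)⁻¹ u + (√θ)⁻¹ v`. [folklore] -/
theorem toPeculiar_eq_add_smul (u : E) (θ : ℝ) (v : E) :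
    toPeculiar u θ v = -((√θ)⁻¹ • u) + (√θ)⁻¹ • v := by
  simp only [toPeculiar, smul_sub]
  abel

/-- The elastic collision law commutes with the peculiar-velocity rescaling (it is linear in the
pair of velocities and translation-covariant; Saint-Raymond 2009 §3.2.2, before (3.16)).
[cite: SaintRaymond2009, §3.2.2 (3.16)] -/
theorem collide_toPeculiar (u : E) (θ : ℝ) (ω : sphere (0 : E) 1) (v w : E) :
    collide ω (toPeculiar u θ v, toPeculiar u θ w) =
      (toPeculiar u θ (collide ω (v, w)).1, toPeculiar u θ (collide ω (v, w)).2) := by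
  have hsub : toPeculiar u θ v - toPeculiar u θ w = (√θ)⁻¹ • (v - w) := by
    simp only [toPeculiar, ← smul_sub, sub_sub_sub_cancel_right]
  simp only [collide, hsub, real_inner_smul_left, Prod.mk.injEq]
  simp only [toPeculiar]
  constructor <;> module

/-- The hard-sphere kernel is positively homogeneous under the rescaling:
`((ξ - ξ_*)·ω)_+ = (√θ)⁻¹ ((v - v_*)·ω)_+` (Saint-Raymond 2009 §3.2.2: `Q(m_λ f, m_λ f) = λ m_λ Q(f,f)`).
[cite: SaintRaymond2009, §3.2.2 (3.16)] -/
theorem hardSphereKernel_toPeculiar (u : E) (θ : ℝ) (ω : sphere (0 : E) 1) (v w : E) :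
    hardSphereKernel (toPeculiar u θ v, toPeculiar u θ w) ω = (√θ)⁻¹ * hardSphereKernel (v, w) ω := by
  have hsub : toPeculiar u θ v - toPeculiar u θ w = (√θ)⁻¹ • (v - w) := by
    simp only [toPeculiar, ← smul_sub, sub_sub_sub_cancel_right]
  have ha : 0 ≤ (√θ)⁻¹ := inv_nonneg.2 (Real.sqrt_nonneg θ)
  simp only [hardSphereKernel, hsub, inner_smul_left, RCLike.conj_to_real]
  rw [mul_max_of_nonneg _ _ ha, mul_zero]

/-- `ofPeculiar u θ` has temperate growth (it is affine). [folklore] -/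
theorem hasTemperateGrowth_ofPeculiar (u : E) (θ : ℝ) :
    Function.HasTemperateGrowth (ofPeculiar u θ) := by
  unfold ofPeculiar; fun_prop

/-- `toPeculiar u θ` has temperate growth (it is affine). [folklore] -/
theorem hasTemperateGrowth_toPeculiar (u : E) (θ : ℝ) :
    Function.HasTemperateGrowth (toPeculiar u θ) := by
  unfold toPeculiar; fun_prop

/-- Temperate growth is preserved by the rescaling. [folklore] -/
theorem comp_ofPeculiar_mem_temperateGrowth {g : E → ℝ} (hg : g ∈ temperateGrowth E) (u : E)
    (θ : ℝ) : g ∘ ofPeculiar u θ ∈ temperateGrowth E :=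
  Function.HasTemperateGrowth.comp hg (hasTemperateGrowth_ofPeculiar u θ)

/-- Temperate growth is preserved by the inverse rescaling. [folklore] -/
theorem comp_toPeculiar_mem_temperateGrowth {g : E → ℝ} (hg : g ∈ temperateGrowth E) (u : E)
    (θ : ℝ) : g ∘ toPeculiar u θ ∈ temperateGrowth E :=
  Function.HasTemperateGrowth.comp hg (hasTemperateGrowth_toPeculiar u θ)

/-- The collision invariants `a + ⟪b, v⟫ + c |v|²` are stable under affine substitutions
`v ↦ u + a v` (Chapman–Cowling 1970 §16.33, footnote †: `m C`, `½ m C²` with a frozen `c₀` are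
summational invariants). [cite: ChapmanCowling1970, §16.33] -/
theorem comp_affine_mem_collisionInvariants {φ : E → ℝ} (hφ : φ ∈ collisionInvariants E) (u : E)
    (a : ℝ) : (fun v => φ (u + a • v)) ∈ collisionInvariants E := by
  obtain ⟨p, c, b, rfl⟩ := mem_collisionInvariants_iff.1 hφ
  refine mem_collisionInvariants_iff.2
    ⟨p + ⟪b, u⟫_ℝ + c * ‖u‖ ^ 2, c * a ^ 2, a • b + (2 * c * a) • u, ?_⟩
  funext v
  simp only [inner_add_right, inner_smul_right, inner_add_left, inner_smul_left,
    RCLike.conj_to_real, norm_add_sq_real, norm_smul, mul_pow, Real.norm_eq_abs, sq_abs]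
  ring

/-- `g ∘ ofPeculiar u θ` is a collision invariant when `g` is. [folklore] -/
theorem comp_ofPeculiar_mem_collisionInvariants {g : E → ℝ} (hg : g ∈ collisionInvariants E)
    (u : E) (θ : ℝ) : g ∘ ofPeculiar u θ ∈ collisionInvariants E :=
  comp_affine_mem_collisionInvariants hg u (√θ)

/-- `g ∘ toPeculiar u θ` is a collision invariant when `g` is. [folklore] -/
theorem comp_toPeculiar_mem_collisionInvariants {g : E → ℝ} (hg : g ∈ collisionInvariants E)
    (u : E) (θ : ℝ) : g ∘ toPeculiar u θ ∈ collisionInvariants E := by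
  have h := comp_affine_mem_collisionInvariants hg (-((√θ)⁻¹ • u)) (√θ)⁻¹
  have heq : (g ∘ toPeculiar u θ) = fun v => g (-((√θ)⁻¹ • u) + (√θ)⁻¹ • v) := by
    funext v
    simp only [Function.comp_apply, toPeculiar_eq_add_smul]
  rwa [heq]

/-- For `θ > 0`, `g ∘ ofPeculiar u θ` is a collision invariant iff `g` is. [folklore] -/
theorem comp_ofPeculiar_mem_collisionInvariants_iff {θ : ℝ} (hθ : 0 < θ) (u : E) (g : E → ℝ) :
    g ∘ ofPeculiar u θ ∈ collisionInvariants E ↔ g ∈ collisionInvariants E := by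
  refine ⟨fun h => ?_, fun h => comp_ofPeculiar_mem_collisionInvariants h u θ⟩
  have h' := comp_toPeculiar_mem_collisionInvariants h u θ
  rwa [comp_ofPeculiar_comp_toPeculiar hθ] at h'

variable [FiniteDimensional ℝ E] [MeasurableSpace E] [BorelSpace E]

/-! ### The `L²(M_{1,u,θ})` pairing and the Gaussian change of variables -/

/-- The `L²` pairing against the unit-density local Maxwellian,
`⟪g, h⟫_{u,θ} = ∫ g(v) h(v) M_{1,u,θ}(v) dv = ∫ g h dN(u, θ I)`, *defined* by transport of
`maxwellianInner` (`M dv = stdGaussian E`) along `ofPeculiar u θ`; see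
`localMaxwellianInner_eq_integral` for the displayed integral (CIP 1994 §7.1 (1.8) at the local
Maxwellian). [cite: CIPDiluteGases1994, §7.1 (1.8)] -/
def localMaxwellianInner (u : E) (θ : ℝ) (g h : E → ℝ) : ℝ :=
  maxwellianInner (g ∘ ofPeculiar u θ) (h ∘ ofPeculiar u θ)

/-- **Gaussian change of variables** `v = u + √θ ξ`: for `θ > 0`,
`∫ F(u + √θ ξ) dN(0, I)(ξ) = ∫ F(v) M_{1,u,θ}(v) dv` (the push-forward of the standard Gaussian under
`ofPeculiar u θ` has density the local Maxwellian `M_{1,u,θ}`; CIP 1994 §3.2 (3.2.15)). No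
integrability is needed (both sides are `0` otherwise). [cite: CIPDiluteGases1994, §3.2 (3.2.15)] -/
theorem integral_comp_ofPeculiar_stdGaussian {θ : ℝ} (hθ : 0 < θ) (u : E) (F : E → ℝ) :
    ∫ ξ, F (ofPeculiar u θ ξ) ∂stdGaussian E = ∫ v, F v * localMaxwellian 1 θ u v := by
  have hc : 0 < √θ := Real.sqrt_pos.2 hθ
  rw [integral_stdGaussian_eq_integral_mul_globalMaxwellian]
  have h1 : (fun ξ : E => globalMaxwellian ξ * F (ofPeculiar u θ ξ)) =
      fun ξ => (fun z : E => globalMaxwellian ((√θ)⁻¹ • z) * F (u + z)) (√θ • ξ) := by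
    funext ξ
    simp only [ofPeculiar, smul_smul, inv_mul_cancel₀ hc.ne', one_smul]
  rw [h1, Measure.integral_comp_smul volume (fun z : E => globalMaxwellian ((√θ)⁻¹ • z) * F (u + z))
    (√θ), ← integral_sub_right_eq_self (μ := (volume : Measure E))
    (fun z : E => globalMaxwellian ((√θ)⁻¹ • z) * F (u + z)) u]
  simp only [add_sub_cancel, smul_eq_mul]
  rw [← integral_const_mul]
  refine integral_congr_ae (Filter.Eventually.of_forall fun v => ?_)
  have hnorm : ‖(√θ)⁻¹ • (v - u)‖ ^ 2 = θ⁻¹ * ‖v - u‖ ^ 2 := by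
    rw [norm_smul, mul_pow, Real.norm_eq_abs, sq_abs, inv_pow, Real.sq_sqrt hθ.le]
  have hexp : rexp (-‖(√θ)⁻¹ • (v - u)‖ ^ 2 / 2) = rexp (-‖v - u‖ ^ 2 / (2 * θ)) := by
    rw [hnorm]
    congr 1
    field_simp
  have hconst : |((√θ) ^ finrank ℝ E)⁻¹| * (2 * π) ^ (-(finrank ℝ E : ℝ) / 2) =
      (2 * π * θ) ^ (-(finrank ℝ E : ℝ) / 2) := by
    rw [abs_of_pos (inv_pos.2 (pow_pos hc _)), Real.mul_rpow (by positivity) hθ.le, mul_comm]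
    congr 1
    rw [neg_div, Real.rpow_neg hθ.le, Real.sqrt_eq_rpow, ← Real.rpow_natCast, ← Real.rpow_mul hθ.le]
    congr 2
    ring
  simp only [globalMaxwellian, localMaxwellian, one_mul, hexp]
  calc |((√θ) ^ finrank ℝ E)⁻¹| * ((2 * π) ^ (-(finrank ℝ E : ℝ) / 2) *
        rexp (-‖v - u‖ ^ 2 / (2 * θ)) * F v)
      = (|((√θ) ^ finrank ℝ E)⁻¹| * (2 * π) ^ (-(finrank ℝ E : ℝ) / 2)) *
          rexp (-‖v - u‖ ^ 2 / (2 * θ)) * F v := by ring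
    _ = F v * ((2 * π * θ) ^ (-(finrank ℝ E : ℝ) / 2) * rexp (-‖v - u‖ ^ 2 / (2 * θ))) := by
          rw [hconst]; ring

/-- The transported pairing is the displayed integral: for `θ > 0`,
`⟪g, h⟫_{u,θ} = ∫ g(v) h(v) M_{1,u,θ}(v) dv` (CIP 1994 §7.1 (1.8)). [cite: CIPDiluteGases1994, §7.1 (1.8)] -/
theorem localMaxwellianInner_eq_integral {θ : ℝ} (hθ : 0 < θ) (u : E) (g h : E → ℝ) :
    localMaxwellianInner u θ g h = ∫ v, g v * h v * localMaxwellian 1 θ u v := by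
  unfold localMaxwellianInner maxwellianInner
  exact integral_comp_ofPeculiar_stdGaussian hθ u (fun v => g v * h v)

omit [BorelSpace E] in
/-- Orthogonality to the collision invariants transports along the rescaling: for `θ > 0`,
`g ⊥_{u,θ} (collision invariants) ↔ (g ∘ ofPeculiar u θ) ⊥_M (collision invariants)`. [folklore] -/
theorem forall_localMaxwellianInner_eq_zero_iff {θ : ℝ} (hθ : 0 < θ) (u : E) (g : E → ℝ) :
    (∀ φ ∈ collisionInvariants E, localMaxwellianInner u θ g φ = 0) ↔
      ∀ φ ∈ collisionInvariants E, maxwellianInner (g ∘ ofPeculiar u θ) φ = 0 := by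
  refine ⟨fun h φ hφ => ?_, fun h φ hφ => h _ (comp_ofPeculiar_mem_collisionInvariants hφ u θ)⟩
  have h' := h (φ ∘ toPeculiar u θ) (comp_toPeculiar_mem_collisionInvariants hφ u θ)
  rwa [localMaxwellianInner, comp_toPeculiar_comp_ofPeculiar hθ] at h'

/-! ### The linearised Enskog operator `𝓛♭` -/

/-- **The linearised Enskog (hard-sphere) collision operator at the local Maxwellian `M_{ρ,u,θ}` with
contact factor `Y`**, `ε = 0` (no delocalisation):
`𝓛♭ g (v) = Y ∫∫ ((v - v_*)·ω)_+ (g(v') + g(v_*') - g(v) - g(v_*)) dω M_{ρ,u,θ}(v_*) dv_*`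
(Chapman–Cowling 1970 (16.33,1) divided by `f⁽⁰⁾ = M_{ρ,u,θ}`, without the cross-section `σ²`;
proved in `linearizedEnskogOperator_eq_integral`). It is *defined* as `Y ρ √θ` times the conjugate
of `hardSphereLinearizedOp` (linearisation around `stdGaussian E`) by the peculiar-velocity map,
`𝓛♭ g = Y ρ √θ · (L (g ∘ ofPeculiar u θ)) ∘ toPeculiar u θ` (Saint-Raymond 2009 (3.16), with the
opposite sign convention: here `𝓛♭` is **non-positive**, like `L`). Junk for `θ ≤ 0` (value `0`).
[cite: ChapmanCowling1970, §16.33 (16.33,1)] -/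
def linearizedEnskogOperator (Y ρ : ℝ) (u : E) (θ : ℝ) (g : E → ℝ) : E → ℝ := fun v =>
  Y * ρ * √θ * hardSphereLinearizedOp (g ∘ ofPeculiar u θ) (toPeculiar u θ v)

/-- In peculiar variables `𝓛♭ g ∘ ofPeculiar = Y ρ √θ · L (g ∘ ofPeculiar)` (`θ > 0`). [folklore] -/
theorem linearizedEnskogOperator_comp_ofPeculiar {θ : ℝ} (hθ : 0 < θ) (Y ρ : ℝ) (u : E)
    (g : E → ℝ) :
    linearizedEnskogOperator Y ρ u θ g ∘ ofPeculiar u θ =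
      fun ξ => Y * ρ * √θ * hardSphereLinearizedOp (g ∘ ofPeculiar u θ) ξ := by
  funext ξ
  simp [linearizedEnskogOperator, toPeculiar_ofPeculiar hθ]

/-- The conjugated linearised hard-sphere operator in original variables: for `θ > 0`,
`L (g ∘ ofPeculiar u θ) ((v - u)/√θ) = (√θ)⁻¹ ∫ (∫ ((v - v_*)·ω)_+ (g' + g_*' - g - g_*) dω) M_{1,u,θ}(v_*) dv_*`
(Saint-Raymond 2009 (3.16)). [cite: SaintRaymond2009, §3.2.2 (3.16)] -/
theorem hardSphereLinearizedOp_comp_ofPeculiar_apply {θ : ℝ} (hθ : 0 < θ) (u : E) (g : E → ℝ)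
    (v : E) :
    hardSphereLinearizedOp (g ∘ ofPeculiar u θ) (toPeculiar u θ v) =
      (√θ)⁻¹ * ∫ w, (∫ ω, hardSphereKernel (v, w) ω *
        (g (collide ω (v, w)).1 + g (collide ω (v, w)).2 - g v - g w) ∂sphereMeasure) *
          localMaxwellian 1 θ u w := by
  set F : E → ℝ := fun w => (√θ)⁻¹ * ∫ ω, hardSphereKernel (v, w) ω *
    (g (collide ω (v, w)).1 + g (collide ω (v, w)).2 - g v - g w) ∂sphereMeasure with hF
  have key : ∀ η : E, (∫ ω, hardSphereKernel (toPeculiar u θ v, η) ω *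
      ((g ∘ ofPeculiar u θ) (collide ω (toPeculiar u θ v, η)).1 +
        (g ∘ ofPeculiar u θ) (collide ω (toPeculiar u θ v, η)).2 -
        (g ∘ ofPeculiar u θ) (toPeculiar u θ v) - (g ∘ ofPeculiar u θ) η) ∂sphereMeasure) =
      F (ofPeculiar u θ η) := by
    intro η
    conv_lhs => rw [← toPeculiar_ofPeculiar hθ u η]
    rw [hF]
    dsimp only
    rw [← integral_const_mul]
    refine integral_congr_ae (Filter.Eventually.of_forall fun ω => ?_)
    dsimp only
    rw [collide_toPeculiar, hardSphereKernel_toPeculiar]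
    simp only [Function.comp_apply, ofPeculiar_toPeculiar hθ]
    ring
  unfold hardSphereLinearizedOp linearizedCollisionOp
  simp_rw [key]
  rw [integral_comp_ofPeculiar_stdGaussian hθ u F, ← integral_const_mul]
  refine integral_congr_ae (Filter.Eventually.of_forall fun w => ?_)
  simp only [hF]
  ring

/-- **`𝓛♭` is the displayed integral operator** (Chapman–Cowling 1970 (16.33,1); CIP 1994 §7.1 (1.6)
at the local Maxwellian): for `θ > 0` and every `g`, `v`,
`𝓛♭ g (v) = Y ∫ (∫ ((v - v_*)·ω)_+ (g(v') + g(v_*') - g(v) - g(v_*)) dω) M_{ρ,u,θ}(v_*) dv_*`.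
[cite: ChapmanCowling1970, §16.33 (16.33,1)] -/
theorem linearizedEnskogOperator_eq_integral {θ : ℝ} (hθ : 0 < θ) (Y ρ : ℝ) (u : E) (g : E → ℝ)
    (v : E) :
    linearizedEnskogOperator Y ρ u θ g v =
      Y * ∫ w, (∫ ω, hardSphereKernel (v, w) ω *
        (g (collide ω (v, w)).1 + g (collide ω (v, w)).2 - g v - g w) ∂sphereMeasure) *
          localMaxwellian ρ θ u w := by
  have hc : (√θ : ℝ) ≠ 0 := (Real.sqrt_pos.2 hθ).ne'
  have h2 : ∫ w, (∫ ω, hardSphereKernel (v, w) ω *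
        (g (collide ω (v, w)).1 + g (collide ω (v, w)).2 - g v - g w) ∂sphereMeasure) *
          localMaxwellian ρ θ u w =
      ρ * ∫ w, (∫ ω, hardSphereKernel (v, w) ω *
        (g (collide ω (v, w)).1 + g (collide ω (v, w)).2 - g v - g w) ∂sphereMeasure) *
          localMaxwellian 1 θ u w := by
    rw [← integral_const_mul]
    refine integral_congr_ae (Filter.Eventually.of_forall fun w => ?_)
    simp only [localMaxwellian, one_mul]
    ring
  rw [linearizedEnskogOperator, hardSphereLinearizedOp_comp_ofPeculiar_apply hθ, h2,
    mul_assoc (Y * ρ), mul_inv_cancel_left₀ hc]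
  ring

/-- **Symmetry of `𝓛♭`** for the `L²(M_{1,u,θ})` pairing on functions of temperate growth:
`⟪h, 𝓛♭ g⟫_{u,θ} = ⟪𝓛♭ h, g⟫_{u,θ}` (`θ > 0`; CIP 1994 §7.1 (1.9), transported;
Chapman–Cowling 1970 §16.33). [cite: CIPDiluteGases1994, §7.1 (1.9)] -/
theorem localMaxwellianInner_linearizedEnskogOperator_comm {θ : ℝ} (hθ : 0 < θ) (Y ρ : ℝ) (u : E)
    {g h : E → ℝ} (hg : g ∈ temperateGrowth E) (hh : h ∈ temperateGrowth E) :
    localMaxwellianInner u θ h (linearizedEnskogOperator Y ρ u θ g) =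
      localMaxwellianInner u θ (linearizedEnskogOperator Y ρ u θ h) g := by
  simp only [localMaxwellianInner, linearizedEnskogOperator_comp_ofPeculiar hθ]
  rw [maxwellianInner_const_mul_right, maxwellianInner_const_mul_left]
  congr 1
  exact maxwellianInner_linearizedCollisionOp_comm_holds
    isGradCutoffKernel_hardSphereKernel.measurable ⟨1, 2, abs_hardSphereKernel_le_two_mul_one_add_norm⟩
    Literature.Analysis.UnboundedOperators.hardSphereKernel_collide_neg
    Literature.Analysis.UnboundedOperators.hardSphereKernel_swap_neg
    (comp_ofPeculiar_mem_temperateGrowth hg u θ) (comp_ofPeculiar_mem_temperateGrowth hh u θ)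

/-- **Non-positivity of `𝓛♭`**: `⟪g, 𝓛♭ g⟫_{u,θ} ≤ 0` for `g` of temperate growth, `θ > 0`,
`Y ρ ≥ 0` (CIP 1994 §7.1 (1.10), transported). [cite: CIPDiluteGases1994, §7.1 (1.10)] -/
theorem localMaxwellianInner_linearizedEnskogOperator_self_nonpos {θ : ℝ} (hθ : 0 < θ) {Y ρ : ℝ}
    (hYρ : 0 ≤ Y * ρ) (u : E) {g : E → ℝ} (hg : g ∈ temperateGrowth E) :
    localMaxwellianInner u θ g (linearizedEnskogOperator Y ρ u θ g) ≤ 0 := by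
  simp only [localMaxwellianInner, linearizedEnskogOperator_comp_ofPeculiar hθ]
  rw [maxwellianInner_const_mul_right]
  exact mul_nonpos_of_nonneg_of_nonpos (mul_nonneg hYρ (Real.sqrt_nonneg θ))
    (maxwellianInner_hardSphereLinearizedOp_self_nonpos_holds (comp_ofPeculiar_mem_temperateGrowth hg u θ))

/-- **Kernel of `𝓛♭`** (CIP 1994 Thm 7.2.1 transported; Chapman–Cowling 1970 §16.33: the
homogeneous solutions are the summational invariants): in velocity dimension `d ≥ 2`, for `θ > 0`,
`Y ρ ≠ 0` and `g` of temperate growth, `𝓛♭ g = 0 ↔ g ∈ span {1, vᵢ, |v|²}`.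
[cite: CIPDiluteGases1994, §7.2 Thm 7.2.1] -/
theorem linearizedEnskogOperator_eq_zero_iff (hE : 2 ≤ finrank ℝ E) {θ : ℝ} (hθ : 0 < θ) {Y ρ : ℝ}
    (hYρ : Y * ρ ≠ 0) (u : E) {g : E → ℝ} (hg : g ∈ temperateGrowth E) :
    linearizedEnskogOperator Y ρ u θ g = 0 ↔ g ∈ collisionInvariants E := by
  have hc : 0 < √θ := Real.sqrt_pos.2 hθ
  have hk : Y * ρ * √θ ≠ 0 := mul_ne_zero hYρ hc.ne'
  rw [← comp_ofPeculiar_mem_collisionInvariants_iff hθ u g,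
    ← hardSphereLinearizedOp_eq_zero_iff_holds hE (comp_ofPeculiar_mem_temperateGrowth hg u θ)]
  constructor
  · intro h
    funext ξ
    have h1 := congrFun h (ofPeculiar u θ ξ)
    simp only [linearizedEnskogOperator, toPeculiar_ofPeculiar hθ, Pi.zero_apply] at h1
    exact (mul_eq_zero.1 h1).resolve_left hk
  · intro h
    funext v
    simp [linearizedEnskogOperator, h]

/-- **Spectral gap of `𝓛♭`** (Grad 1963; Baranger–Mouhot 2005 Thm 1.1; transported): in velocity
dimension `d ≥ 2` there is `λ > 0` (the gap of `L` around the standard Gaussian) such that for all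
`θ > 0`, `Y ρ ≥ 0` and `g` of temperate growth `⊥_{u,θ}` the collision invariants,
`Y ρ √θ λ ⟪g, g⟫_{u,θ} ≤ -⟪g, 𝓛♭ g⟫_{u,θ}`. [cite: BarangerMouhot2005, Thm 1.1] -/
theorem linearizedEnskogOperator_spectralGap (hE : 2 ≤ finrank ℝ E) :
    ∃ lam : ℝ, 0 < lam ∧ ∀ (Y ρ : ℝ) (u : E) (θ : ℝ), 0 < θ → 0 ≤ Y * ρ →
      ∀ g ∈ temperateGrowth E,
        (∀ φ ∈ collisionInvariants E, localMaxwellianInner u θ g φ = 0) →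
          Y * ρ * √θ * lam * localMaxwellianInner u θ g g ≤
            -localMaxwellianInner u θ g (linearizedEnskogOperator Y ρ u θ g) := by
  obtain ⟨lam, hlam, h⟩ := le_neg_maxwellianInner_hardSphereLinearizedOp_of_orthogonal_holds hE
  refine ⟨lam, hlam, fun Y ρ u θ hθ hYρ g hg horth => ?_⟩
  have h1 := h _ (comp_ofPeculiar_mem_temperateGrowth hg u θ)
    ((forall_localMaxwellianInner_eq_zero_iff hθ u g).1 horth)
  simp only [localMaxwellianInner, linearizedEnskogOperator_comp_ofPeculiar hθ]
  rw [maxwellianInner_const_mul_right]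
  have h2 := mul_le_mul_of_nonneg_left h1 (mul_nonneg hYρ (Real.sqrt_nonneg θ))
  calc Y * ρ * √θ * lam * maxwellianInner (g ∘ ofPeculiar u θ) (g ∘ ofPeculiar u θ)
      = Y * ρ * √θ * (lam * maxwellianInner (g ∘ ofPeculiar u θ) (g ∘ ofPeculiar u θ)) := by ring
    _ ≤ _ := h2
    _ = _ := by ring

/-! ### The Chapman–Enskog pseudo-inverse -/

/-- `g` is a **Chapman–Enskog solution** for the datum `A` (w.r.t. the linearised hard-sphere operator
`L` around the standard Gaussian): `g` has temperate growth, is `M`-orthogonal to the collision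
invariants, and `L g = A` (Saint-Raymond 2009 Remark 3.2.3: `𝓛_M⁻¹` on `(Ker 𝓛_M)^⊥`;
Chapman–Cowling 1970 §7.31: the solutions `A`, `B` made unique by orthogonality conditions).
[cite: SaintRaymond2009, §3.2.2 Remark 3.2.3] -/
def IsChapmanEnskogSolution (A g : E → ℝ) : Prop :=
  g ∈ temperateGrowth E ∧ (∀ φ ∈ collisionInvariants E, maxwellianInner g φ = 0) ∧
    hardSphereLinearizedOp g = A

open scoped Classical in
/-- **The Chapman–Enskog pseudo-inverse `L⁻¹ A`** of the linearised hard-sphere operator around the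
standard Gaussian: the temperate-growth solution of `L g = A` that is `M`-orthogonal to the collision
invariants (unique when it exists, `IsChapmanEnskogSolution.unique`), and the **junk value `0`** when
no such solution exists (e.g. when `A` is not orthogonal to the collision invariants). Existence for
`A ∈ (Ker L)^⊥` is the Fredholm alternative in `L²(M dv)` (Saint-Raymond 2009 Prop. 3.2.2 and
Remark 3.2.3, `Φ̃ = 𝓛⁻¹Φ`, `Ψ̃ = 𝓛⁻¹Ψ`), not vendored here. [cite: SaintRaymond2009, §3.2.2 Remark 3.2.3] -/
def chapmanEnskogInv (A : E → ℝ) : E → ℝ :=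
  if h : ∃ g, IsChapmanEnskogSolution A g then h.choose else 0

/-- If a Chapman–Enskog solution exists, `chapmanEnskogInv A` is one. [folklore] -/
theorem chapmanEnskogInv_spec {A : E → ℝ} (h : ∃ g, IsChapmanEnskogSolution A g) :
    IsChapmanEnskogSolution A (chapmanEnskogInv A) := by
  rw [chapmanEnskogInv, dif_pos h]
  exact h.choose_spec

/-- The documented junk value: `chapmanEnskogInv A = 0` when no Chapman–Enskog solution exists.
[folklore] -/
theorem chapmanEnskogInv_of_not_exists {A : E → ℝ} (h : ¬ ∃ g, IsChapmanEnskogSolution A g) :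
    chapmanEnskogInv A = 0 := by
  rw [chapmanEnskogInv, dif_neg h]

omit [FiniteDimensional ℝ E] [MeasurableSpace E] [BorelSpace E] in
/-- The integrand of `L g (v)` for `g` of temperate growth: continuous in `(v_*, ω)` and bounded by
`C (1 + |v_*|)^m`. [folklore] -/
theorem continuous_and_abs_linearizedIntegrand_le {g : E → ℝ} (hg : g.HasTemperateGrowth) (v : E) :
    ∃ (C : ℝ) (m : ℕ), (Continuous fun p : E × sphere (0 : E) 1 => hardSphereKernel (v, p.1) p.2 *
        (g (collide p.2 (v, p.1)).1 + g (collide p.2 (v, p.1)).2 - g v - g p.1)) ∧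
      ∀ (w : E) (ω : sphere (0 : E) 1), |hardSphereKernel (v, w) ω *
        (g (collide ω (v, w)).1 + g (collide ω (v, w)).2 - g v - g w)| ≤ C * (1 + ‖w‖) ^ m := by
  obtain ⟨k, C, hC0, hC⟩ := exists_abs_le_of_hasTemperateGrowth hg
  have hgc : Continuous g := hg.1.continuous
  refine ⟨4 * C * (1 + ‖v‖) ^ (k + 1), k + 1, ?_, fun w ω => ?_⟩
  · have hcoll : Continuous fun p : E × sphere (0 : E) 1 => collide p.2 (v, p.1) := by
      unfold collide; fun_prop
    refine Continuous.mul (by unfold hardSphereKernel; fun_prop) ?_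
    exact (((hgc.comp (continuous_fst.comp hcoll)).add (hgc.comp (continuous_snd.comp hcoll))).sub
      continuous_const).sub (hgc.comp continuous_fst)
  · set X : ℝ := (1 + ‖v‖) * (1 + ‖w‖) with hX
    have hX1 : 1 ≤ X := by rw [hX]; nlinarith [norm_nonneg v, norm_nonneg w]
    have hB : hardSphereKernel (v, w) ω ≤ X := by
      refine (hardSphereKernel_le_abs_inner_add_norm v w ω).trans ?_
      rw [hX]; nlinarith [abs_inner_sphere_le v ω, mul_nonneg (norm_nonneg v) (norm_nonneg w)]
    have hgX : ∀ u : E, 1 + ‖u‖ ≤ X → |g u| ≤ C * X ^ k := fun u hu =>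
      (hC u).trans (mul_le_mul_of_nonneg_left (pow_le_pow_left₀ (by positivity) hu k) hC0)
    have h1 := hgX _ (one_add_norm_collide_fst_le ω (v, w))
    have h2 := hgX _ (one_add_norm_collide_snd_le ω (v, w))
    have h3 := hgX v (one_add_norm_fst_le (v, w))
    have h4 := hgX w (one_add_norm_snd_le (v, w))
    have hsum : |g (collide ω (v, w)).1 + g (collide ω (v, w)).2 - g v - g w| ≤ 4 * (C * X ^ k) := by
      refine (abs_sub _ _).trans ((add_le_add ((abs_sub _ _).trans
        (add_le_add (abs_add_le _ _) le_rfl)) le_rfl).trans ?_)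
      linarith
    rw [abs_mul, abs_of_nonneg (show 0 ≤ hardSphereKernel (v, w) ω from le_max_right _ _)]
    calc hardSphereKernel (v, w) ω * |g (collide ω (v, w)).1 + g (collide ω (v, w)).2 - g v - g w|
        ≤ X * (4 * (C * X ^ k)) := mul_le_mul hB hsum (abs_nonneg _) (by positivity)
      _ = 4 * C * (1 + ‖v‖) ^ (k + 1) * (1 + ‖w‖) ^ (k + 1) := by rw [hX, mul_pow]; ring

/-- **Additivity of `L` on functions of temperate growth**: `L (g₁ - g₂) = L g₁ - L g₂` (all
integrals converge absolutely; CIP 1994 §7.1 (1.6): `L` is linear). [cite: CIPDiluteGases1994, §7.1 (1.6)] -/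
theorem hardSphereLinearizedOp_sub {g₁ g₂ : E → ℝ} (hg₁ : g₁ ∈ temperateGrowth E)
    (hg₂ : g₂ ∈ temperateGrowth E) :
    hardSphereLinearizedOp (g₁ - g₂) = hardSphereLinearizedOp g₁ - hardSphereLinearizedOp g₂ := by
  funext v
  obtain ⟨C₁, m₁, hc₁, hb₁⟩ := continuous_and_abs_linearizedIntegrand_le (g := g₁) hg₁ v
  obtain ⟨C₂, m₂, hc₂, hb₂⟩ := continuous_and_abs_linearizedIntegrand_le (g := g₂) hg₂ v
  have hs₁ := integrable_sphere_section hc₁ hb₁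
  have hs₂ := integrable_sphere_section hc₂ hb₂
  have hI₁ := integrable_integral_sphere hc₁ hb₁
  have hI₂ := integrable_integral_sphere hc₂ hb₂
  simp only [hardSphereLinearizedOp, linearizedCollisionOp, Pi.sub_apply]
  rw [← integral_sub hI₁ hI₂]
  refine integral_congr_ae (Filter.Eventually.of_forall fun w => ?_)
  dsimp only
  rw [← integral_sub (hs₁ w) (hs₂ w)]
  refine integral_congr_ae (Filter.Eventually.of_forall fun ω => ?_)
  ring

/-- **Uniqueness of Chapman–Enskog solutions** (velocity dimension `d ≥ 2`): two temperate-growth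
solutions of `L g = A` orthogonal to the collision invariants coincide — their difference lies in
`Ker L = span {1, vᵢ, |v|²}` (CIP 1994 Thm 7.2.1) and is orthogonal to it (Saint-Raymond 2009
Remark 3.2.3; Chapman–Cowling 1970 §7.31). [cite: SaintRaymond2009, §3.2.2 Remark 3.2.3] -/
theorem IsChapmanEnskogSolution.unique (hE : 2 ≤ finrank ℝ E) {A g₁ g₂ : E → ℝ}
    (h₁ : IsChapmanEnskogSolution A g₁) (h₂ : IsChapmanEnskogSolution A g₂) : g₁ = g₂ := by
  obtain ⟨hg₁, ho₁, hL₁⟩ := h₁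
  obtain ⟨hg₂, ho₂, hL₂⟩ := h₂
  have hφ : g₁ - g₂ ∈ temperateGrowth E := sub_mem hg₁ hg₂
  have hL : hardSphereLinearizedOp (g₁ - g₂) = 0 := by
    rw [hardSphereLinearizedOp_sub hg₁ hg₂, hL₁, hL₂, sub_self]
  have hmem : g₁ - g₂ ∈ collisionInvariants E := (hardSphereLinearizedOp_eq_zero_iff_holds hE hφ).1 hL
  have hzero : maxwellianInner (g₁ - g₂) (g₁ - g₂) = 0 := by
    rw [maxwellianInner_sub_left (integrable_mul_stdGaussian hg₁ hφ)
      (integrable_mul_stdGaussian hg₂ hφ), ho₁ _ hmem, ho₂ _ hmem, sub_self]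
  by_contra hne
  have hne' : g₁ - g₂ ≠ 0 := sub_ne_zero.2 hne
  exact (maxwellianInner_self_pos hφ hne').ne' hzero

/-- Consequently `chapmanEnskogInv A` *is* the Chapman–Enskog solution whenever one exists
(`d ≥ 2`). [folklore] -/
theorem IsChapmanEnskogSolution.chapmanEnskogInv_eq (hE : 2 ≤ finrank ℝ E) {A g : E → ℝ}
    (h : IsChapmanEnskogSolution A g) : chapmanEnskogInv A = g :=
  (chapmanEnskogInv_spec ⟨g, h⟩).unique hE h

/-- **The Chapman–Enskog pseudo-inverse `𝓛♭⁻¹` of the linearised Enskog operator** at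
`(Y, ρ, u, θ)`: transport of `chapmanEnskogInv`,
`𝓛♭⁻¹ A = (L⁻¹ ((Y ρ √θ)⁻¹ · A ∘ ofPeculiar u θ)) ∘ toPeculiar u θ`
(Chapman–Cowling 1970 (16.33,5)–(16.33,6): the Enskog second approximation is the dilute
Chapman–Enskog solution in peculiar variables divided by `n χ`; Saint-Raymond 2009 (3.16)). For
`θ > 0`, `Y ρ ≠ 0` it returns the temperate-growth solution of `𝓛♭ g = A` that is
`⊥_{u,θ}` the collision invariants when one exists (`linearizedEnskogOperatorInv_spec`), else `0`.
[cite: ChapmanCowling1970, §16.33 (16.33,6)] -/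
def linearizedEnskogOperatorInv (Y ρ : ℝ) (u : E) (θ : ℝ) (A : E → ℝ) : E → ℝ :=
  chapmanEnskogInv ((Y * ρ * √θ)⁻¹ • (A ∘ ofPeculiar u θ)) ∘ toPeculiar u θ

/-- Transport of the solution notion: for `θ > 0`, `Y ρ ≠ 0`, `g` is a temperate-growth solution of
`𝓛♭ g = A` orthogonal (`⊥_{u,θ}`) to the collision invariants iff `g ∘ ofPeculiar u θ` is a
Chapman–Enskog solution for the datum `(Y ρ √θ)⁻¹ · A ∘ ofPeculiar u θ`. [folklore] -/
theorem isChapmanEnskogSolution_comp_ofPeculiar_iff {θ : ℝ} (hθ : 0 < θ) {Y ρ : ℝ} (hYρ : Y * ρ ≠ 0)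
    (u : E) (A g : E → ℝ) :
    IsChapmanEnskogSolution ((Y * ρ * √θ)⁻¹ • (A ∘ ofPeculiar u θ)) (g ∘ ofPeculiar u θ) ↔
      g ∈ temperateGrowth E ∧ (∀ φ ∈ collisionInvariants E, localMaxwellianInner u θ g φ = 0) ∧
        linearizedEnskogOperator Y ρ u θ g = A := by
  have hc : 0 < √θ := Real.sqrt_pos.2 hθ
  have hk : Y * ρ * √θ ≠ 0 := mul_ne_zero hYρ hc.ne'
  have e1 : g ∘ ofPeculiar u θ ∈ temperateGrowth E ↔ g ∈ temperateGrowth E := by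
    refine ⟨fun h => ?_, fun h => comp_ofPeculiar_mem_temperateGrowth h u θ⟩
    have h' := comp_toPeculiar_mem_temperateGrowth h u θ
    rwa [comp_ofPeculiar_comp_toPeculiar hθ] at h'
  have e3 : hardSphereLinearizedOp (g ∘ ofPeculiar u θ) = (Y * ρ * √θ)⁻¹ • (A ∘ ofPeculiar u θ) ↔
      linearizedEnskogOperator Y ρ u θ g = A := by
    constructor
    · intro h
      funext v
      rw [linearizedEnskogOperator, h, Pi.smul_apply, Function.comp_apply, ofPeculiar_toPeculiar hθ,
        smul_eq_mul, mul_inv_cancel_left₀ hk]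
    · intro h
      funext ξ
      have h1 := congrFun h (ofPeculiar u θ ξ)
      rw [linearizedEnskogOperator, toPeculiar_ofPeculiar hθ] at h1
      rw [Pi.smul_apply, Function.comp_apply, smul_eq_mul, ← h1, inv_mul_cancel_left₀ hk]
  rw [IsChapmanEnskogSolution, e1, e3, forall_localMaxwellianInner_eq_zero_iff hθ]

/-- **Specification of `𝓛♭⁻¹`**: for `θ > 0`, `Y ρ ≠ 0`, if `𝓛♭ g = A` has a temperate-growth solution
`⊥_{u,θ}` the collision invariants, then `𝓛♭⁻¹ A` has temperate growth, is `⊥_{u,θ}` the collision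
invariants and solves `𝓛♭ (𝓛♭⁻¹ A) = A` (Chapman–Cowling 1970 (16.33,6)). [cite: ChapmanCowling1970, §16.33 (16.33,6)] -/
theorem linearizedEnskogOperatorInv_spec {θ : ℝ} (hθ : 0 < θ) {Y ρ : ℝ} (hYρ : Y * ρ ≠ 0) (u : E)
    {A : E → ℝ} (h : ∃ g ∈ temperateGrowth E,
      (∀ φ ∈ collisionInvariants E, localMaxwellianInner u θ g φ = 0) ∧
        linearizedEnskogOperator Y ρ u θ g = A) :
    linearizedEnskogOperatorInv Y ρ u θ A ∈ temperateGrowth E ∧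
      (∀ φ ∈ collisionInvariants E,
        localMaxwellianInner u θ (linearizedEnskogOperatorInv Y ρ u θ A) φ = 0) ∧
      linearizedEnskogOperator Y ρ u θ (linearizedEnskogOperatorInv Y ρ u θ A) = A := by
  obtain ⟨g, hg, ho, hL⟩ := h
  have hex : ∃ G, IsChapmanEnskogSolution ((Y * ρ * √θ)⁻¹ • (A ∘ ofPeculiar u θ)) G :=
    ⟨g ∘ ofPeculiar u θ, (isChapmanEnskogSolution_comp_ofPeculiar_iff hθ hYρ u A g).2 ⟨hg, ho, hL⟩⟩
  have hspec := chapmanEnskogInv_spec hex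
  rw [← isChapmanEnskogSolution_comp_ofPeculiar_iff hθ hYρ u A]
  rwa [linearizedEnskogOperatorInv, comp_toPeculiar_comp_ofPeculiar hθ]

/-- **Uniqueness for `𝓛♭⁻¹`** (`d ≥ 2`, `θ > 0`, `Y ρ ≠ 0`): any temperate-growth solution of `𝓛♭ g = A`
that is `⊥_{u,θ}` the collision invariants equals `𝓛♭⁻¹ A`. [folklore] -/
theorem linearizedEnskogOperatorInv_eq_of_solution (hE : 2 ≤ finrank ℝ E) {θ : ℝ} (hθ : 0 < θ)
    {Y ρ : ℝ} (hYρ : Y * ρ ≠ 0) (u : E) {A g : E → ℝ} (hg : g ∈ temperateGrowth E)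
    (ho : ∀ φ ∈ collisionInvariants E, localMaxwellianInner u θ g φ = 0)
    (hL : linearizedEnskogOperator Y ρ u θ g = A) :
    linearizedEnskogOperatorInv Y ρ u θ A = g := by
  have hG := (isChapmanEnskogSolution_comp_ofPeculiar_iff hθ hYρ u A g).2 ⟨hg, ho, hL⟩
  rw [linearizedEnskogOperatorInv, hG.chapmanEnskogInv_eq hE, comp_ofPeculiar_comp_toPeculiar hθ]

/-! ### The delocalised operator -/

section Deloc

variable {ι : Type*} [Fintype ι] {X : Type*}

/-- **The delocalised linearised Enskog collision operator** for hard spheres of diameter `ε` in a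
position space `X` with geometry `G` (translations by `EuclideanSpace ℝ ι`), at the *frozen* local
Maxwellian `M_{ρ,u,θ}` with *constant* contact factor `Y`, acting on `g(x, v)`:
`𝓛_ε g (x, v) = Y ∫∫ ((v - v_*)·ω)_+ [g(x, v') + g(x - εω, v_*') - g(x, v) - g(x + εω, v_*)] dω M_{ρ,u,θ}(v_*) dv_*`,
the linearisation `F = Y M(v) M(v_*) (1 + g + g_*)` of the Enskog collision term
(Chapman–Cowling 1970 (16.3,4); Soto 2016 (4.87): loss partner at `x + εω`, gain partner at `x - εω`;
same geometry as `Literature.Analysis.FluidPDE.hsCollisionTerm` after `ω ↦ -ω` in the gain term),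
divided by `M_{ρ,u,θ}(v)`; no cross-section prefactor. Junk value `0` of the Bochner integrals.
The revised-Enskog linearisation with `x`-dependent `(Y, ρ, u, θ)` is NOT this operator.
[cite: ChapmanCowling1970, §16.3 (16.3,4)] -/
def linearizedEnskogOperatorDeloc (G : Geometry ι X) (ε Y ρ : ℝ) (u : EuclideanSpace ℝ ι) (θ : ℝ)
    (g : X → EuclideanSpace ℝ ι → ℝ) (x : X) (v : EuclideanSpace ℝ ι) : ℝ :=
  Y * ∫ w, (∫ ω, hardSphereKernel (v, w) ω *
      (g x (collide ω (v, w)).1 +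
        g (G.translate x (-(ε • (ω : EuclideanSpace ℝ ι)))) (collide ω (v, w)).2 -
        g x v - g (G.translate x (ε • (ω : EuclideanSpace ℝ ι))) w) ∂sphereMeasure) *
    localMaxwellian ρ θ u w

/-- At `ε = 0` the delocalised operator is `𝓛♭` acting in the velocity variable at fixed `x`
(`θ > 0`; Chapman–Cowling 1970 §16.31: "if the gas is uniform … an expression differing from that
obtained earlier only by the presence of the factor `χ`"). [cite: ChapmanCowling1970, §16.31] -/
theorem linearizedEnskogOperatorDeloc_zero {θ : ℝ} (hθ : 0 < θ) (G : Geometry ι X) (Y ρ : ℝ)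
    (u : EuclideanSpace ℝ ι) (g : X → EuclideanSpace ℝ ι → ℝ) (x : X) (v : EuclideanSpace ℝ ι) :
    linearizedEnskogOperatorDeloc G 0 Y ρ u θ g x v = linearizedEnskogOperator Y ρ u θ (g x) v := by
  rw [linearizedEnskogOperator_eq_integral hθ, linearizedEnskogOperatorDeloc]
  simp only [zero_smul, neg_zero, Geometry.translate_zero]

end Deloc

end

end Literature.MathematicalPhysics.KineticTheory
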